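/- Copyright: the b2b-balaban cell (near-miss cell 7), T⁴-continuum fan-out; row NE7b ROUND-2 swarm, seat
t4-ne7b-formalise-leaf-01 (gen 9) (road W-RP, row «W-2T» file 5 «NON-VACUITY (t5)» — over W-2T file 2
`HistoryChessboardGibbsCellsRoad` p229916 and leaf-03 g6's W7-opt (t5) `HistoryChessboardGibbsWitness` p229713).  Released
under the licence of the surrounding project. -/
import Summits.QuantumFields.BalabanUV.T4Continuum.Support.HistoryChessboardGibbsCellsRoad
import Summits.QuantumFields.BalabanUV.T4Continuum.Support.HistoryChessboardGibbsWitness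

/-!
# Road W-RP: THE TWO-TERM EVENT MODEL, file 5 — the cell-road witness shape is INHABITED (node test (t5))

Summits-side support leaf of the T⁴-continuum cell (rung (B)+1 on a FINITE torus only; NOT infinite volume, NOT the
mass gap, NOT the Clay statement; NOT a proof of the spine estimate NE7b).  Row NE7b, road **W-RP**, row «W-2T» (owner
booking v3.60), file 5: the NON-VACUITY node test of file 2's hypothesis shape `CellRoadWitness` — the twin of leaf-03
g6's W7-opt (t5) `HistoryChessboardGibbsWitness.gibbsWitnessOf` (p229713) and of leaf-02 g10's W6-opt (b)
`HistoryChessboardApexWitness.witnessOf` (p226019), read through the cell road.  [decided toy] ONE data def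
(`cellWitnessOf`, a structure VALUE) over TREE theorems BY NAME (W-E1's E1 identity `integral_exp_mul_prodObs_dens_zero`,
p226019's `ZOf` ∕ `ZOf_pos` ∕ `nuOf` ∕ `exp_nuOf_mul`, S12h's `prodObs_nil` ∕ `prodObs_eq_one`); nothing printed asserted,
no `[cite:]` tag, no `Prop`-valued FACT minted (c1), no constant (c2∕c6), no exit ∕ socket ∕ `HistoryConstants` file touched
(c3).

WHAT.  §1 `badEv_empty` ∕ `twoEv_empty_false` (with NO pattern the small-field event is the whole tower),
**`weight_twoEv_empty_false`**: `weight D g₀ os K (twoEv ∅ E) t false = ZOf D g₀ os K t` (W-E1's E1 identity on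
`Set.univ`), `cellSide_empty` (file 1's five clauses with no pattern, rate `0`).  §2 for ANY datum `D` with measurable
averagings (`hM`), any run `g₀` and any string `os` whose product observable is identically `1` (`hobs` — every string
over a subsingleton gauge group, the EMPTY string over any regular group): **`cellWitnessOf D hM hobs : CellRoadWitness D
g₀ os Unit 0`** — NO pattern, no cell events, rates `0`, cubes of side `L^0`, `l₀ = vol = 1`, `K₀ = 0`, and the AGGREGATE
sandwich WITH EQUALITY (`Cc := ν := nuOf`, radii and recent constants `0`, rates `0`); `nonempty_cellRoadWitness_of_prodObs`,
`nonempty_cellRoadWitness_nil`; §3 over a SUBSINGLETON gauge group: `nonempty_cellRoadWitness`, **`forSmallCouplings_cellRoadWitness`**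
= file 2's headline binder `hData` VERBATIM for every datum with `hM`; §4 the cell road's ENDs FIRE on the toy: the empty
string at every (0.4)-block-averaged `SU(n)` datum (`example`, statement = leaf-03 g6's `stringHybridNE7_nil_fires`) and, at
`SU(1)`, `forSmallCouplings_cellRoadWitness_SU1`, **`hybridNE7Under_fires_SU1_cellRoad`** (`hybridNE7Under_of_cellRoad_fsc`
APPLIED) and the four prefixed targets (`example`, statement = `targets_fire_SU1`); `toGibbsWitness` of the toy has W7-opt's
window and threshold (definitionally).

LOCATED CONTENT (honest, decided): the cell-road witness — bad event = union of the cell events, zero shells, ONE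
aggregate sandwich — is inhabited EXACTLY where W7's and W6's witnesses are (modulo `D.AvgMeasurable`): removing the term
layer costs nothing in non-vacuity; with NO pattern the chessboard side is vacuous BY DESIGN and for a trivial observable
the sandwich is an identity; the (B)-antecedent headline is exercised by no toy (as for W6 ∕ W7 ∕ the count road).  A node
test of a SHAPE; discharges NOTHING of the nine; NE7b NOT proved; 0∕9.  HONEST DEPENDENCY (cell): continuum YM on T⁴ ⇐
BetaPertH ∧ nine spine estimates (0/9 proved); BetaPertH ⇐ (D1) ∧ (D4) ∧ CAP+tail; G-an2-4 gates asym, D1 and NE2/3/4.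
This file changes none of it. -/

open Finset MeasureTheory
open Literature.Barriers.CriticalPhenomena.NonGibbs
open Literature.MathematicalPhysics.QuantumFieldTheory.Balaban1983to89
open Literature.MathematicalPhysics.QuantumFieldTheory.Balaban1983to89.Missing
open Literature.MathematicalPhysics.QuantumFieldTheory.Balaban1983to89.T4Continuum
open Literature.MathematicalPhysics.QuantumFieldTheory.Balaban1983to89.T4FiniteEpsInhabited
open Summit.QuantumFields.BalabanUV.T4Continuum
open HistoryRPTowerLaw HistoryChessboardEventsCubes HistoryChessboardTowerRepr HistoryChessboardGibbsSide HistoryChessboardGibbs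
open HistoryChessboardGibbsCells HistoryChessboardGibbsCellsRoad
open HistoryChessboardApexWitness HistoryChessboardGibbsWitness
open HistoryRealiseCellsRunApexWitness HistoryRealiseCellsRunApexWitnessData

namespace Summit.QuantumFields.BalabanUV.T4Continuum.HistoryChessboardGibbsCellsWitness

noncomputable section

/-! ## §1 No pattern: the small-field event is the whole tower and its weight is the datum's dressed integral -/

section NoPattern

variable {F : T4Family} {G : Type} {Λ : Type*} {m₁ K : ℕ}
  {E : Λ → BlockIdx 4 (cubeCount F m₁) → Set (Tower (F.P K) G K)}

/-- With NO pattern the large-field event is EMPTY. [folklore] -/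
theorem badEv_empty : badEv (∅ : Finset Λ) E = ∅ := by
  simp [badEv]

/-- … and the small-field event is the WHOLE tower. [folklore] -/
theorem twoEv_empty_false : twoEv (∅ : Finset Λ) E false = Set.univ := by
  show (badEv (∅ : Finset Λ) E)ᶜ = Set.univ
  rw [badEv_empty, Set.compl_empty]

variable [GaugeGroup G] [MeasurableSpace G] [HaarData G] [RegularGaugeGroup G]

/-- **THE WEIGHT OF THE SMALL-FIELD TERM WITH NO PATTERN IS THE DATUM's DRESSED INTEGRAL** `ZOf D g₀ os K t =
∫ e^{t·prodObs} ρ₀ dU` — W-E1's E1 identity `integral_exp_mul_prodObs_dens_zero` on `Set.univ`. [folklore] -/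
theorem weight_twoEv_empty_false (D : FiniteEpsData F G) (hM : D.AvgMeasurable) (g₀ : ℕ → ℝ) (os : List (ULoop F))
    (t : ℝ) : weight D g₀ os K (twoEv (∅ : Finset Λ) E) t false = ZOf D g₀ os K t := by
  show Zrun D K (g₀ K) * ∫ ω in twoEv (∅ : Finset Λ) E false, Real.exp (t * obsTower K os ω) ∂gibbsTower D g₀ K = _
  rw [twoEv_empty_false, setIntegral_univ]
  exact (integral_exp_mul_prodObs_dens_zero D hM g₀ K os t).symm

omit [RegularGaugeGroup G] in
/-- file 1's five-clause `CellSide` with NO pattern holds at every cutoff with rate `0` (any cell events). [folklore] -/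
theorem cellSide_empty (D : FiniteEpsData F G) (g₀ : ℕ → ℝ) (hm₁ : m₁ ≤ F.m) :
    CellSide D g₀ hm₁ K (∅ : Finset Λ) E 0 where
  E_meas _ h := (Finset.notMem_empty _ h).elim
  loc _ h := (Finset.notMem_empty _ h).elim
  sym _ h := (Finset.notMem_empty _ h).elim
  univ_le _ h := (Finset.notMem_empty _ h).elim
  r_nonneg := le_rfl

end NoPattern

/-! ## §2 The cell-road witness on the real towers: any datum with measurable averagings, trivial observable -/

section Witness

variable {F : T4Family} {G : Type} [GaugeGroup G] [MeasurableSpace G] [HaarData G] [RegularGaugeGroup G]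

/-- **THE CELL-ROAD WITNESS TERM** on ANY datum `D` with measurable averagings, for any run `g₀` and any string `os` whose
product observable is identically `1`: NO pattern (no cell events, rates `0`, cubes of side `L^0`), `l₀ = vol = 1`, `K₀ = 0`,
and the aggregate sandwich WITH EQUALITY — `Cc K t := ν K := nuOf D g₀ os K`, radii ∕ recent constants `0`, rates `0`
(the weights of the small-field terms are `ZOf D g₀ os K t` ∕ `ZOf D g₀ os (K+1) t` by `weight_twoEv_empty_false`, and
`e^{nuOf K}·ZOf K t = ZOf (K+1) t` is p226019's `exp_nuOf_mul`). [decided toy] -/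
def cellWitnessOf (D : FiniteEpsData F G) (hM : D.AvgMeasurable) {g₀ : ℕ → ℝ} {os : List (ULoop F)}
    (hobs : ∀ (K : ℕ) (U : GaugeField (F.P K) 0 G), T4GenFunBounds.prodObs (D.scheme g₀) K os U = 1) :
    CellRoadWitness D g₀ os Unit 0 where
  hm₁ := Nat.zero_le _
  l₀ := 1
  vol := 1
  l₀_pos := one_pos
  vol_pos := one_pos
  K₀ := 0
  P := ∅
  E _ _ _ := ∅
  r _ := 0
  E' _ _ _ := ∅
  r' _ := 0
  cellA K _ := cellSide_empty D g₀ (Nat.zero_le _)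
  cellB K _ := cellSide_empty D g₀ (Nat.zero_le _)
  sum_r := summable_zero
  sum_r' := summable_zero
  Cc K _ := nuOf D g₀ os K
  Rr _ _ := 0
  CcRec _ _ := 0
  RrRec _ _ := 0
  ν := nuOf D g₀ os
  u _ := 0
  s₂ _ := 0
  c₀ _ := 0
  rr _ := 0
  s _ := 0
  sandwich :=
    { lower := fun K t _ _ => by
        rw [weight_twoEv_empty_false D hM g₀ os t, weight_twoEv_empty_false D hM g₀ os t, sub_zero]
        exact (exp_nuOf_mul hobs K t).le
      upper := fun K t _ _ => by
        rw [weight_twoEv_empty_false D hM g₀ os t, weight_twoEv_empty_false D hM g₀ os t, add_zero]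
        exact (exp_nuOf_mul hobs K t).ge
      uv_const := fun _ _ _ _ => by simp
      uv_radius := fun _ _ _ _ => by simp
      recent_remainder := fun _ _ _ _ => by simp
      recent_deviation := fun _ _ _ _ => by simp }
  sum_rr := summable_zero
  sum_u := summable_zero
  sum_s := summable_zero
  sum_s₂ := summable_zero

/-- **THE SHAPE IS INHABITED on ANY datum with measurable averagings, for any run and any string with trivial product
observable.** [decided toy] -/
theorem nonempty_cellRoadWitness_of_prodObs (D : FiniteEpsData F G) (hM : D.AvgMeasurable) {g₀ : ℕ → ℝ}
    {os : List (ULoop F)} (hobs : ∀ (K : ℕ) (U : GaugeField (F.P K) 0 G), T4GenFunBounds.prodObs (D.scheme g₀) K os U = 1) :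
    Nonempty (CellRoadWitness D g₀ os Unit 0) :=
  ⟨cellWitnessOf D hM hobs⟩

/-- **… IN PARTICULAR FOR THE EMPTY STRING: ANY datum with measurable averagings, ANY regular gauge group, ANY run**
(S12h's `prodObs_nil`). [decided toy] -/
theorem nonempty_cellRoadWitness_nil (D : FiniteEpsData F G) (hM : D.AvgMeasurable) (g₀ : ℕ → ℝ) :
    Nonempty (CellRoadWitness D g₀ ([] : List (ULoop F)) Unit 0) :=
  nonempty_cellRoadWitness_of_prodObs D hM fun K U => prodObs_nil _ (D.scheme g₀) K U

/-- The toy's Gibbs witness (file 2's `toGibbsWitness`) has W7-opt's window, volume factor and threshold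
(definitionally). [decided toy] -/
example (D : FiniteEpsData F G) (hM : D.AvgMeasurable) {g₀ : ℕ → ℝ} {os : List (ULoop F)}
    (hobs : ∀ (K : ℕ) (U : GaugeField (F.P K) 0 G), T4GenFunBounds.prodObs (D.scheme g₀) K os U = 1) :
    (cellWitnessOf D hM hobs).toGibbsWitness.l₀ = (gibbsWitnessOf D hM hobs).l₀ ∧
      (cellWitnessOf D hM hobs).toGibbsWitness.vol = (gibbsWitnessOf D hM hobs).vol ∧
      (cellWitnessOf D hM hobs).toGibbsWitness.K₀ = (gibbsWitnessOf D hM hobs).K₀ :=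
  ⟨rfl, rfl, rfl⟩

end Witness

/-! ## §3 Over a subsingleton gauge group: every string; file 2's headline binder verbatim -/

section Subsingleton

variable {F : T4Family} {G : Type} [GaugeGroup G] [MeasurableSpace G] [HaarData G] [RegularGaugeGroup G]
  [Subsingleton G]

/-- over a subsingleton gauge group the shape is inhabited for EVERY datum with measurable averagings, run and string
(`prodObs_eq_one`). [decided toy] -/
theorem nonempty_cellRoadWitness (D : FiniteEpsData F G) (hM : D.AvgMeasurable) (g₀ : ℕ → ℝ) (os : List (ULoop F)) :
    Nonempty (CellRoadWitness D g₀ os Unit 0) :=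
  nonempty_cellRoadWitness_of_prodObs D hM fun K U => prodObs_eq_one D g₀ K os U

/-- **FILE 2's HEADLINE BINDER `hData` HOLDS, VERBATIM, for EVERY datum with measurable averagings over a subsingleton
gauge group** (`ForSmallCouplings.of_forall`). [decided toy] -/
theorem forSmallCouplings_cellRoadWitness (D : FiniteEpsData F G) (hM : D.AvgMeasurable) :
    T4ContinuumYM4Torus.ForSmallCouplings D fun g₀ => ∀ os : List (ULoop F),
      ∃ (Λ : Type) (m₁ : ℕ), Nonempty (CellRoadWitness D g₀ os Λ m₁) :=
  T4ContinuumYM4Torus.ForSmallCouplings.of_forall fun g₀ os => ⟨Unit, 0, nonempty_cellRoadWitness D hM g₀ os⟩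

end Subsingleton

/-! ## §4 The cell road's ENDs fire on the toy (plumbing tests) -/

section SUn

variable {F : T4Family} {n : ℕ} [NeZero n] {ℰ : LoopAverage (Matrix.specialUnitaryGroup (Fin n) ℂ)}

/-- **THE CELL ROAD'S PER-WITNESS END FIRES FOR THE EMPTY STRING AT EVERY `SU(n)`**: for every (0.4)-block-averaged
`SU(n)` datum with a measurable small-loop average and every run, the apex lineage's per-string hybrid-NE7 datum of the
EMPTY string holds from some cutoff on, with window `l₀ = vol = 1` (`stringHybridNE7_of_cellRoad` APPLIED to
`cellWitnessOf`; an `example` — the STATEMENT is leaf-03 g6's `stringHybridNE7_nil_fires`, reached here by the cell road).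
[decided toy] -/
example (D : FiniteEpsData F (Matrix.specialUnitaryGroup (Fin n) ℂ))
    (hBA : D.IsBlockAveraged ℰ) (hE : ℰ.MeasurableE) (g₀ : ℕ → ℝ) :
    ∃ K, 0 ≤ K ∧ T4MatchingAssembly.StringHybridNE7 (D.scheme g₀) ([] : List (ULoop F)) 1 1 K :=
  stringHybridNE7_of_cellRoad hBA hE
    (cellWitnessOf D (hBA.avgMeasurable hE) fun K U => prodObs_nil _ (D.scheme g₀) K U)

end SUn

section SU1

variable {F : T4Family} {ℰ : LoopAverage (Matrix.specialUnitaryGroup (Fin 1) ℂ)}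

/-- file 2's headline binder holds for every (0.4)-block-averaged `SU(1)` datum with a measurable small-loop average.
[decided toy] -/
theorem forSmallCouplings_cellRoadWitness_SU1 (D : FiniteEpsData F (Matrix.specialUnitaryGroup (Fin 1) ℂ))
    (hBA : D.IsBlockAveraged ℰ) (hE : ℰ.MeasurableE) :
    T4ContinuumYM4Torus.ForSmallCouplings D fun g₀ => ∀ os : List (ULoop F),
      ∃ (Λ : Type) (m₁ : ℕ), Nonempty (CellRoadWitness D g₀ os Λ m₁) :=
  haveI := subsingleton_SU1
  forSmallCouplings_cellRoadWitness D (hBA.avgMeasurable hE)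

/-- **AT `SU(1)` THE CELL ROAD'S PIN-FREE APEX INPUT FIRES**: `HybridNE7Under D (BetaPertHyp D.βfun)` for every
(0.4)-block-averaged `SU(1)` datum with a measurable small-loop average (`hybridNE7Under_of_cellRoad_fsc` APPLIED; the two
antecedents accepted and unused — a plumbing certificate at the trivial group, not physics). [decided toy] -/
theorem hybridNE7Under_fires_SU1_cellRoad (D : FiniteEpsData F (Matrix.specialUnitaryGroup (Fin 1) ℂ))
    (hBA : D.IsBlockAveraged ℰ) (hE : ℰ.MeasurableE) : T4ApexHybrid.HybridNE7Under D (BetaPertHyp D.βfun) :=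
  hybridNE7Under_of_cellRoad_fsc D hBA hE (forSmallCouplings_cellRoadWitness_SU1 D hBA hE)

/-- … and so do the four prefixed T⁴ targets (`targets_of_cellRoad_fsc` APPLIED; an `example` — the STATEMENT is leaf-03
g6's `targets_fire_SU1`, reached by the cell road; each target carries `(B)` and `BetaPertHyp` as its own antecedents —
exercised by no toy). [decided toy] -/
example (D : FiniteEpsData F (Matrix.specialUnitaryGroup (Fin 1) ℂ))
    (hBA : D.IsBlockAveraged ℰ) (hE : ℰ.MeasurableE) :
    D.ym4_torus_continuum_limit_exists ∧ D.ym4_torus_continuum_limit_unique ∧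
      D.limit_reflectionPositive ∧ D.limit_torusCovariant :=
  targets_of_cellRoad_fsc D hBA hE (forSmallCouplings_cellRoadWitness_SU1 D hBA hE)

end SU1

end

end Summit.QuantumFields.BalabanUV.T4Continuum.HistoryChessboardGibbsCellsWitness
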